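import Summits.BirchSwinnertonDyer.BirchSwinnertonDyer.Theorems.ThetaPartnerAtTwoSignedControlAtTwoShaTwoPrimaryVanishing
import Summits.BirchSwinnertonDyer.BirchSwinnertonDyer.Theorems.ThetaPartnerAtTwoSignedControlAtTwoLocalHTwoPrimaryTorsion
import HarnessLib

/-!
# `Ш²(K, E[p^∞]) = 0` over a TOTALLY REAL number field when `Sel_{p^∞}(E/K)` is finite and `E(K)[p] = 0` —
# granted three generic Poitou–Tate facts (K4 Prop-4.12 elimination lane, part 4c: the clean general statement)

Route `ThetaPartnerAtTwo` (TP2; crux shared with `ResidualThetaTransportAtTwo`), crux K4 `SignedControlAtTwo`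
(stmt-BirchSwinnertonDyer-20309), line `eulerchar` v11. Seat `prover-bsd-wall-tp2-p3-w2` (width seat 2/3, gen 5).

Parts 4a–4b (`…ShaTwoPrimaryFinite`, `…ShaTwoPrimaryVanishing`) proved `Ш²(K, E[p^∞])` finite and `p`-divisible, hence `0`, for a
totally real `K`, modulo two technical inputs: the vanishing of the local `H²(K_v, E[p^∞])` at the finite places (`hfin`) and
`E[p^∞]^{Γ_K} = 0` (`hΓ`).  Both are now tree theorems for EVERY number field: `hfin` is seat bsd-inputs-k4-p1's
`SignedEC.PrimaryTorsionH2.subsingleton_galoisCohomology_two_toLocal_primaryTorsion` (p612138: `cd_p(Γ_{K_v}) ≤ 2`, `E[p^∞]`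
`p`-divisible, `#H²(K_v, E[p^k]) = #E(K_v)[p^k]` bounded), and `hΓ` follows from `E(K)[p] = 0` (`eq_zero_of_forall_smul_eq`).  Hence:

* `forall_mem_shaTwo_primary_eq_zero_of_isTotallyReal` — **for `E/K` elliptic over a totally real number field `K`, a prime `p` with
  `E(K)[p] = 0` and `Sel_{p^∞}(E/K)` finite, every everywhere-locally-trivial class of `H²(K, E[p^∞])` vanishes**, granted the named
  facts `poitouTate_sha_tateDual K` (Milne I Thm. 4.10 (a)), `poitouTate_three_realPlaces_injective K` (Thm. 4.10 (c), `r = 3`) and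
  `poitouTate_two_realPlaces_surjective K` (Cor. 4.16).  This is Milne, *ADT*, I Thm. 6.13 (c)'s finite kernel `Ш²` being `0` on such
  rows (in print: `Ш²(K, E[p^∞]) ≅ Ш¹(K, T_pE)^∨` and `Ш¹(K, T_pE) ⊆ lim← Sel_{p^n} = 0`); usable verbatim by the odd-`p` rows
  (`19097` and the other Prop-4.12 consumers), not only by K4.
* `localization_inr_primary_eq_zero` — the `hfin` input as an equation (any `K`, any finite `v`).
HONEST FRAMING: THEOREMS ONLY (no definition, no named fact, no `sorry`); a `conditional-result` on three cited named facts taken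
as hypotheses; closes no item by itself; BSD is not proved by any of this.

References: [MilneADT2006] I Thm. 4.10 (a),(c), Cor. 4.16, Lemma 6.12, Thm. 6.13 (c); [GreenbergLNM1716] §4 p. 119, Appendix p. 113;
[JetchevSkinnerWan2017] Lemma 3.3.3.
-/

set_option autoImplicit false
-- the Theorems namespace of this sub repeats the summit name by design (D-0017 nested layout)
set_option linter.dupNamespace false

noncomputable section

open scoped Classical NumberField

open NumberField IsDedekindDomain Field WeierstrassCurve
open Literature.NumberTheory.EllipticCurves Literature.NumberTheory.GaloisRepresentations
open Literature.NumberTheory.GaloisRepresentations.DiscreteGaloisModule (shaTwo)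
open Literature.NumberTheory.GaloisCohomology
open Summit.BirchSwinnertonDyer.Rank1Residual.X11b (LocBridge.primaryGaloisModule)

namespace Summit.BirchSwinnertonDyer.BirchSwinnertonDyer.Theorems.SignedEC.ShaTwo

variable {K : Type} [Field K] [NumberField K] (W : WeierstrassCurve K) [W.IsElliptic] (p : ℕ) [Fact p.Prime]

/-- **`H²(K_v, E[p^∞]) = 0` at every finite place `v` of any number field** (the `hfin` input of part 4b), as an equation, for the
tree's Galois module `LocBridge.primaryGaloisModule W p` (bsd-inputs-k4-p1's `subsingleton_galoisCohomology_two_toLocal_primaryTorsion`).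
[cite: MilneADT2006, Ch. I, Cor. 2.3 and §3] [cite: GreenbergLNM1716, §4 Appendix p. 113] -/
theorem localization_inr_primary_eq_zero (v : HeightOneSpectrum (𝓞 K))
    (Z : galoisCohomology ((LocBridge.primaryGaloisModule W p).toLocal (Sum.inr v)) 2) : Z = 0 := by
  haveI := PrimaryTorsionH2.subsingleton_galoisCohomology_two_toLocal_primaryTorsion W p v
    (LocBridge.primaryGaloisModule W p) fun _ _ ↦ rfl
  exact Subsingleton.elim _ _

/-- **`Ш²(K, E[p^∞]) = 0` over a totally real number field `K` when `E(K)[p] = 0` and `Sel_{p^∞}(E/K)` is finite**, granted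
Poitou–Tate duality of `Ш` at finite level (`poitouTate_sha_tateDual K`: `Ш²` FINITE, part 4a) and the two archimedean rows of
Poitou–Tate (`poitouTate_three_realPlaces_injective K`, `poitouTate_two_realPlaces_surjective K`: `Ш²` `p`-DIVISIBLE, part 4b),
all three named facts taken as hypotheses; the local vanishing at finite places and `E[p^∞]^{Γ_K} = 0` are theorems.
[cite: MilneADT2006, Ch. I, Thm. 4.10 (a),(c), Cor. 4.16, Thm. 6.13 (c)] [cite: GreenbergLNM1716, §4 p. 119] -/
theorem forall_mem_shaTwo_primary_eq_zero_of_isTotallyReal [IsTotallyReal K] (hPT : poitouTate_sha_tateDual K)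
    (h3 : poitouTate_three_realPlaces_injective K) (h2 : poitouTate_two_realPlaces_surjective K)
    (hK : ∀ P : W.toAffine.Point, p • P = 0 → P = 0) [Finite (W.selmerGroupPInfty p)] :
    ∀ c ∈ shaTwo (LocBridge.primaryGaloisModule W p), c = 0 :=
  forall_mem_shaTwo_primary_eq_zero W p hPT h3 h2 (localization_inr_primary_eq_zero W p)
    fun _ hQ ↦ W.eq_zero_of_forall_smul_eq (p := p) hK fun σ ↦ hQ σ

end Summit.BirchSwinnertonDyer.BirchSwinnertonDyer.Theorems.SignedEC.ShaTwo

end
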